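import Summits.Ventures.PercRepro.C026TwoHubMain

/-!
# THEOREM B without the terminal edge: `(G⅔)` on the two-hub class with NON-ADJACENT terminals
(p6, gen 22)

`G.attachTwoHubOpen a b h h'` is the hub graph `G` (with `a, b` edgeless) plus the four hub edges
`0 = h–a`, `1 = h–b`, `2 = h'–a`, `3 = h'–b` only — the two-hub skeleton WITHOUT the terminal edge
(the smallest 2-connected skeleton with Bad sources, `K₂,₃` with the marks on the 3-side, is the
case `G = {c–h, c–h'}`).  ROW C-041 `(G⅔)` holds there too, by REDUCTION to THEOREM B
(C026TwoHubMain, `twoHub_goodDegree`) on `H = G.attachTwoHub a b h h'` = the same skeleton with the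
terminal edge `4 = a–b` added:

* `extend S₀ := Sum.elim (S₀ ∘ inl) (Fin.snoc (S₀ ∘ inr) true)` colours the terminal edge red; every
  `(D,A)` source of the open skeleton extends to a source of `H` (`DA_extend`), injectively — so
  `n(D,A)(H₀) ≤ n(D,A)(H)`;
* every `Good_t` source `T` of `H` restricts to a `Good_t` source of the open skeleton
  (`restrict_good_of_good`): the avoiding walk never uses the edge `a–b` (it avoids `a` resp. `b`),
  and its last edge is a red hub edge `x–t'` whose hub `x ∉ D_t` has a red edge to `t` as well, so
  `c` reaches both terminals without the terminal edge; restriction is injective on the sources of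
  `H` (their terminal edge is red) — so `#Good_t(H) ≤ #Good_t(H₀)`;
* hence `2·n(D,A)(H₀) ≤ 2·n(D,A)(H) ≤ 3·(#Good_a(H) + #Good_b(H)) ≤ 3·(#Good_a(H₀) + #Good_b(H₀))`
  (`twoHubOpen_goodDegree`, C026TwoHubOpenMain), and THEOREM L2 on the open two-hub class
  (`pFun_threeCells_nonneg_twoHubOpen`, there).

This file: the open attachment, extension / restriction, the walk transfer between `H₀` and `H`,
`DA_extend` and the `Good_a` half `restrict_goodA_of_goodA`; C026TwoHubOpenMain has the `Good_b`
half, the three counting inequalities and the two theorems.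

Nothing in the paper of record covers this class; it is the first class of skeletons with
NON-ADJACENT terminals of degree ≥ 2 not adjacent to the probe (the open regime of MINE3-GLUING
§40 (a)) on which `(G⅔)` and THEOREM L2 are kernel theorems.
-/

namespace PercRepro

namespace MultiGraph

open Finset

variable {V E : Type*}

/-- **The open two-hub attachment**: `G` (with `a`, `b` edgeless in it) plus the four hub edges
`0 = h–a`, `1 = h–b`, `2 = h'–a`, `3 = h'–b` — no terminal edge. -/
def attachTwoHubOpen (G : MultiGraph V E) (a b h h' : V) : MultiGraph V (E ⊕ Fin 4) where
  fst := Sum.elim G.fst ![h, h, h', h']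
  snd := Sum.elim G.snd ![a, b, a, b]

variable {G : MultiGraph V E} {a b h h' c : V}

/-- The open attachment is the attachment with the terminal edge removed: the edge `Sum.inr i`
of the open skeleton is the edge `Sum.inr (Fin.castSucc i)` of `H`, with the same endpoints. -/
theorem attachTwoHubOpen_fst (f : E ⊕ Fin 4) :
    (G.attachTwoHubOpen a b h h').fst f =
      (G.attachTwoHub a b h h').fst (Sum.map id Fin.castSucc f) := by
  rcases f with e | i
  · rfl
  · fin_cases i <;> rfl

/-- Second endpoints agree likewise. -/
theorem attachTwoHubOpen_snd (f : E ⊕ Fin 4) :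
    (G.attachTwoHubOpen a b h h').snd f =
      (G.attachTwoHub a b h h').snd (Sum.map id Fin.castSucc f) := by
  rcases f with e | i
  · rfl
  · fin_cases i <;> rfl

/-- **Extension by a red terminal edge**: a configuration of the open skeleton read on `H`. -/
def extendOpen (S₀ : Config (E ⊕ Fin 4)) : Config (E ⊕ Fin 5) :=
  Sum.elim (fun e => S₀ (Sum.inl e)) (Fin.snoc (fun i => S₀ (Sum.inr i)) true)

/-- **Restriction** of a configuration of `H` to the open skeleton. -/
def restrictOpen (S : Config (E ⊕ Fin 5)) : Config (E ⊕ Fin 4) :=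
  fun f => S (Sum.map id Fin.castSucc f)

/-- The extension agrees with the configuration on the edges of the open skeleton. -/
theorem extendOpen_map (S₀ : Config (E ⊕ Fin 4)) (f : E ⊕ Fin 4) :
    extendOpen S₀ (Sum.map id Fin.castSucc f) = S₀ f := by
  rcases f with e | i
  · rfl
  · simp [extendOpen, Fin.snoc_castSucc]

/-- The terminal edge is red in the extension. -/
theorem extendOpen_last (S₀ : Config (E ⊕ Fin 4)) : extendOpen S₀ (Sum.inr 4) = true := by
  simp [extendOpen]
  rfl

/-- Restriction undoes extension. -/
theorem restrictOpen_extendOpen (S₀ : Config (E ⊕ Fin 4)) : restrictOpen (extendOpen S₀) = S₀ := by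
  funext f
  exact extendOpen_map S₀ f

/-- Extension undoes restriction on the configurations whose terminal edge is red. -/
theorem extendOpen_restrictOpen {S : Config (E ⊕ Fin 5)} (h4 : S (Sum.inr 4) = true) :
    extendOpen (restrictOpen S) = S := by
  funext f
  rcases f with e | i
  · rfl
  · refine Fin.lastCases ?_ (fun j => ?_) i
    · exact (extendOpen_last _).trans h4.symm
    · exact extendOpen_map (restrictOpen S) (Sum.inr j)

/-- A step of the open skeleton is a step of `H` in the extension (and in any configuration
agreeing with `S₀` on the open edges). -/
theorem openAdj_attach_of_openAdj_open {S₀ : Config (E ⊕ Fin 4)} {S : Config (E ⊕ Fin 5)}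
    (hS : ∀ f, S (Sum.map id Fin.castSucc f) = S₀ f) {x y : V}
    (hxy : (G.attachTwoHubOpen a b h h').OpenAdj S₀ x y) : (G.attachTwoHub a b h h').OpenAdj S x y := by
  obtain ⟨f, hf, hend⟩ := hxy
  refine ⟨Sum.map id Fin.castSucc f, by rw [hS]; exact hf, ?_⟩
  rw [attachTwoHubOpen_fst, attachTwoHubOpen_snd] at hend
  exact hend

/-- A step of `H` not using the terminal edge is a step of the open skeleton. -/
theorem openAdj_open_of_openAdj_attach {S₀ : Config (E ⊕ Fin 4)} {S : Config (E ⊕ Fin 5)}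
    (hS : ∀ f, S (Sum.map id Fin.castSucc f) = S₀ f) {x y : V}
    (hxy : (G.attachTwoHub a b h h').OpenAdj S x y) (hxa : x ≠ a) (hya : y ≠ a) :
    (G.attachTwoHubOpen a b h h').OpenAdj S₀ x y := by
  obtain ⟨f, hf, hend⟩ := hxy
  rcases f with e | i
  · refine ⟨Sum.inl e, by rw [← hS (Sum.inl e)]; exact hf, hend⟩
  · induction i using Fin.lastCases with
    | last =>
      exfalso
      rcases hend with ⟨h1, _⟩ | ⟨h1, _⟩
      · exact hxa (show a = x from h1).symm
      · exact hya (show a = y from h1).symm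
    | cast j =>
      refine ⟨Sum.inr j, by rw [← hS (Sum.inr j)]; exact hf, ?_⟩
      rw [attachTwoHubOpen_fst, attachTwoHubOpen_snd]
      exact hend

/-- Connections of the open skeleton are connections of `H`. -/
theorem conn_attach_of_conn_open {S₀ : Config (E ⊕ Fin 4)} {S : Config (E ⊕ Fin 5)}
    (hS : ∀ f, S (Sum.map id Fin.castSucc f) = S₀ f) {x y : V}
    (hxy : (G.attachTwoHubOpen a b h h').Conn S₀ x y) : (G.attachTwoHub a b h h').Conn S x y := by
  unfold Conn at hxy ⊢
  induction hxy with
  | refl => exact Relation.ReflTransGen.refl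
  | tail _ hst ih => exact ih.tail (openAdj_attach_of_openAdj_open hS hst)

/-- The complement of the extension agrees with the complement on the open edges. -/
theorem compl_extendOpen_map (S₀ : Config (E ⊕ Fin 4)) (f : E ⊕ Fin 4) :
    (extendOpen S₀)ᶜ (Sum.map id Fin.castSucc f) = S₀ᶜ f := by
  rw [compl_apply_not, compl_apply_not, extendOpen_map]

/-- Blue connections of `H` (terminal edge red) are blue connections of the open skeleton: the
blue edges are the same. -/
theorem conn_open_compl_of_conn_attach_compl {S₀ : Config (E ⊕ Fin 4)} {x y : V}
    (hxy : (G.attachTwoHub a b h h').Conn (extendOpen S₀)ᶜ x y) :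
    (G.attachTwoHubOpen a b h h').Conn S₀ᶜ x y := by
  unfold Conn at hxy ⊢
  induction hxy with
  | refl => exact Relation.ReflTransGen.refl
  | tail _ hst ih =>
    refine ih.tail ?_
    obtain ⟨f, hf, hend⟩ := hst
    rcases f with e | i
    · exact ⟨Sum.inl e, by rw [← compl_extendOpen_map S₀ (Sum.inl e)]; exact hf, hend⟩
    · induction i using Fin.lastCases with
      | last =>
        exfalso
        rw [compl_apply_not] at hf
        have := extendOpen_last S₀
        rw [show (Fin.last 4 : Fin 5) = 4 from rfl, this] at hf
        exact Bool.false_ne_true hf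
      | cast j =>
        refine ⟨Sum.inr j, by rw [← compl_extendOpen_map S₀ (Sum.inr j)]; exact hf, ?_⟩
        rw [attachTwoHubOpen_fst, attachTwoHubOpen_snd]
        exact hend

/-- The blue clusters of `H` (terminal edge red) and of the open skeleton coincide. -/
theorem cluster_compl_extendOpen (S₀ : Config (E ⊕ Fin 4)) (v : V) :
    (G.attachTwoHub a b h h').cluster (extendOpen S₀)ᶜ v = (G.attachTwoHubOpen a b h h').cluster S₀ᶜ v := by
  ext u
  simp only [mem_cluster]
  constructor
  · exact conn_open_compl_of_conn_attach_compl
  · intro hvu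
    refine conn_attach_of_conn_open (S := (extendOpen S₀)ᶜ) ?_ hvu
    intro f
    exact compl_extendOpen_map S₀ f

section Transfer

variable (hab : a ≠ b) (hca : c ≠ a) (hcb : c ≠ b) (hha : h ≠ a) (hhb : h ≠ b) (hh'a : h' ≠ a)
  (hh'b : h' ≠ b) (hisoa : ∀ e, G.fst e ≠ a ∧ G.snd e ≠ a) (hisob : ∀ e, G.fst e ≠ b ∧ G.snd e ≠ b)

/-- **A source of the open skeleton extends to a source of `H`.** -/
theorem DA_extend {S₀ : Config (E ⊕ Fin 4)}
    (hS : ((G.attachTwoHubOpen a b h h').Conn S₀ c a ∧ (G.attachTwoHubOpen a b h h').Conn S₀ c b) ∧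
      (¬ (G.attachTwoHubOpen a b h h').Conn S₀ᶜ c a ∧ ¬ (G.attachTwoHubOpen a b h h').Conn S₀ᶜ c b ∧
        ¬ (G.attachTwoHubOpen a b h h').Conn S₀ᶜ a b)) :
    ((G.attachTwoHub a b h h').Conn (extendOpen S₀) c a ∧
        (G.attachTwoHub a b h h').Conn (extendOpen S₀) c b) ∧
      (¬ (G.attachTwoHub a b h h').Conn (extendOpen S₀)ᶜ c a ∧
        ¬ (G.attachTwoHub a b h h').Conn (extendOpen S₀)ᶜ c b ∧
        ¬ (G.attachTwoHub a b h h').Conn (extendOpen S₀)ᶜ a b) :=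
  ⟨⟨conn_attach_of_conn_open (extendOpen_map S₀) hS.1.1,
      conn_attach_of_conn_open (extendOpen_map S₀) hS.1.2⟩,
    fun hc => hS.2.1 (conn_open_compl_of_conn_attach_compl hc),
    fun hc => hS.2.2.1 (conn_open_compl_of_conn_attach_compl hc),
    fun hc => hS.2.2.2 (conn_open_compl_of_conn_attach_compl hc)⟩

/-- A walk of `H` avoiding a set containing `a` never uses the terminal edge, so it is a walk of the
open skeleton (in the restriction). -/
theorem walkAvoiding_open_of_walkAvoiding_attach {S : Config (E ⊕ Fin 5)} {W : Set V} (haW : a ∈ W)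
    {x y : V} (hw : (G.attachTwoHub a b h h').WalkAvoiding S W x y) :
    (G.attachTwoHubOpen a b h h').WalkAvoiding (restrictOpen S) W x y := by
  obtain ⟨hx, hwalk⟩ := hw
  refine ⟨hx, ?_⟩
  induction hwalk using Relation.ReflTransGen.head_induction_on with
  | refl => exact Relation.ReflTransGen.refl
  | @head u u' huu' _ ih =>
    refine Relation.ReflTransGen.head ⟨?_, huu'.2⟩ (ih huu'.2)
    exact openAdj_open_of_openAdj_attach (fun _ => rfl) huu'.1 (fun h => hx (h ▸ haW))
      (fun h => huu'.2 (h ▸ haW))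

/-- A step of `H` not using the terminal edge is a step of the open skeleton (the `b`-side form). -/
theorem openAdj_open_of_openAdj_attach' {S₀ : Config (E ⊕ Fin 4)} {S : Config (E ⊕ Fin 5)}
    (hS : ∀ f, S (Sum.map id Fin.castSucc f) = S₀ f) {x y : V}
    (hxy : (G.attachTwoHub a b h h').OpenAdj S x y) (hxb : x ≠ b) (hyb : y ≠ b) :
    (G.attachTwoHubOpen a b h h').OpenAdj S₀ x y := by
  obtain ⟨f, hf, hend⟩ := hxy
  rcases f with e | i
  · refine ⟨Sum.inl e, by rw [← hS (Sum.inl e)]; exact hf, hend⟩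
  · induction i using Fin.lastCases with
    | last =>
      exfalso
      rcases hend with ⟨_, h2⟩ | ⟨_, h2⟩
      · exact hyb (show b = y from h2).symm
      · exact hxb (show b = x from h2).symm
    | cast j =>
      refine ⟨Sum.inr j, by rw [← hS (Sum.inr j)]; exact hf, ?_⟩
      rw [attachTwoHubOpen_fst, attachTwoHubOpen_snd]
      exact hend

/-- A walk of `H` avoiding a set containing `b` never uses the terminal edge either. -/
theorem walkAvoiding_open_of_walkAvoiding_attach' {S : Config (E ⊕ Fin 5)} {W : Set V} (hbW : b ∈ W)
    {x y : V} (hw : (G.attachTwoHub a b h h').WalkAvoiding S W x y) :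
    (G.attachTwoHubOpen a b h h').WalkAvoiding (restrictOpen S) W x y := by
  obtain ⟨hx, hwalk⟩ := hw
  refine ⟨hx, ?_⟩
  induction hwalk using Relation.ReflTransGen.head_induction_on with
  | refl => exact Relation.ReflTransGen.refl
  | @head u u' huu' _ ih =>
    refine Relation.ReflTransGen.head ⟨?_, huu'.2⟩ (ih huu'.2)
    exact openAdj_open_of_openAdj_attach' (fun _ => rfl) huu'.1 (fun h => hx (h ▸ hbW))
      (fun h => huu'.2 (h ▸ hbW))

/-- A walk of the open skeleton avoiding `W` is a walk of `H` avoiding `W`, in the extension. -/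
theorem walkAvoiding_attach_of_walkAvoiding_open {S₀ : Config (E ⊕ Fin 4)} {W : Set V} {x y : V}
    (hw : (G.attachTwoHubOpen a b h h').WalkAvoiding S₀ W x y) :
    (G.attachTwoHub a b h h').WalkAvoiding (extendOpen S₀) W x y :=
  ⟨hw.1, reflTransGen_of_imp
    (fun _ _ hxy => ⟨openAdj_attach_of_openAdj_open (extendOpen_map S₀) hxy.1, hxy.2⟩) hw.2⟩

include hab hca hcb hha hhb hh'a hh'b hisoa hisob in
/-- **A `Good_a` source of `H` restricts to a `Good_a` source of the open skeleton**: the avoiding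
walk to `b` is a walk of the open skeleton, and its last edge is a red hub edge whose hub has a red
edge to `a` as well (a blue one would put the hub into `D_a`). -/
theorem restrict_goodA_of_goodA {S : Config (E ⊕ Fin 5)}
    (hS : ((G.attachTwoHub a b h h').Conn S c a ∧ (G.attachTwoHub a b h h').Conn S c b) ∧
      (¬ (G.attachTwoHub a b h h').Conn Sᶜ c a ∧ ¬ (G.attachTwoHub a b h h').Conn Sᶜ c b ∧
        ¬ (G.attachTwoHub a b h h').Conn Sᶜ a b))
    (hg : (G.attachTwoHub a b h h').WalkAvoiding S ((G.attachTwoHub a b h h').cluster Sᶜ a) c b) :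
    (((G.attachTwoHubOpen a b h h').Conn (restrictOpen S) c a ∧
        (G.attachTwoHubOpen a b h h').Conn (restrictOpen S) c b) ∧
      (¬ (G.attachTwoHubOpen a b h h').Conn (restrictOpen S)ᶜ c a ∧
        ¬ (G.attachTwoHubOpen a b h h').Conn (restrictOpen S)ᶜ c b ∧
        ¬ (G.attachTwoHubOpen a b h h').Conn (restrictOpen S)ᶜ a b)) ∧
      (G.attachTwoHubOpen a b h h').WalkAvoiding (restrictOpen S)
        ((G.attachTwoHubOpen a b h h').cluster (restrictOpen S)ᶜ a) c b := by
  have h4 : S (Sum.inr 4) = true := ((DA_attach_iff hab hca hcb hha hhb hh'a hh'b hisoa hisob S).1 hS).1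
  have hext : extendOpen (restrictOpen S) = S := extendOpen_restrictOpen h4
  -- the Good walk, in the open skeleton
  have hDa : (G.attachTwoHub a b h h').cluster Sᶜ a =
      (G.attachTwoHubOpen a b h h').cluster (restrictOpen S)ᶜ a := by
    rw [← hext, cluster_compl_extendOpen, restrictOpen_extendOpen]
  have hg' := walkAvoiding_open_of_walkAvoiding_attach (G := G) (h := h) (h' := h')
    (W := (G.attachTwoHub a b h h').cluster Sᶜ a)
    ((G.attachTwoHub a b h h').self_mem_cluster _ a) hg
  rw [hDa] at hg'
  -- `c ~ a` in the open skeleton: the hub at the end of the walk has a red edge to `a`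
  have hca' : (G.attachTwoHubOpen a b h h').Conn (restrictOpen S) c a := by
    obtain ⟨h01, h23, _, _, _, _, _, _, _⟩ :=
      ((DA_attach_iff hab hca hcb hha hhb hh'a hh'b hisoa hisob S).1 hS).2
    have hcb' : c ∉ ({b} : Set V) := by simpa using hcb
    obtain ⟨x, hx, w, hw, hwalk, hxw⟩ := exists_entry hg.2 hcb' (Set.mem_singleton b)
    rw [Set.mem_singleton_iff] at hw hx
    rw [hw] at hxw
    have hwalk' : (G.attachTwoHub a b h h').WalkAvoiding S
        ((G.attachTwoHub a b h h').cluster Sᶜ a ∪ {b}) c x :=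
      walkAvoiding_union_of_walkAvoiding hcb' hwalk hg.1
    have hxDa : x ∉ (G.attachTwoHub a b h h').cluster Sᶜ a := fun hmem =>
      hwalk'.not_mem_right (Or.inl hmem)
    have hcx : (G.attachTwoHubOpen a b h h').Conn (restrictOpen S) c x :=
      (walkAvoiding_open_of_walkAvoiding_attach (G := G) (h := h) (h' := h')
        (Set.mem_union_left _ ((G.attachTwoHub a b h h').self_mem_cluster _ a)) hwalk').conn
    obtain ⟨f, hf, hend⟩ := hxw.1
    rcases f with e | i
    · exfalso
      rcases hend with ⟨_, h2⟩ | ⟨h1, _⟩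
      · exact (hisob e).2 h2
      · exact (hisob e).1 h1
    · fin_cases i
      · exfalso
        rcases hend with ⟨_, h2⟩ | ⟨h1, _⟩
        · exact hab (show a = b from h2)
        · exact hhb (show h = b from h1)
      · rcases hend with ⟨h1, _⟩ | ⟨h1, _⟩
        · have hxh : x = h := (show h = x from h1).symm
          rw [hxh] at hcx hxDa
          have h0 : S (Sum.inr 0) = true := by
            by_contra h0
            rw [Bool.not_eq_true] at h0
            exact hxDa (subset_cluster_compl_a (Or.inl (Or.inr ⟨h0, G.self_mem_cluster _ h⟩)))
          exact hcx.trans (Conn.of_openAdj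
            ((G.attachTwoHubOpen a b h h').openAdj_of_open (Sum.inr 0) h0))
        · exact absurd (show h = b from h1) hhb
      · exfalso
        rcases hend with ⟨_, h2⟩ | ⟨h1, _⟩
        · exact hab (show a = b from h2)
        · exact hh'b (show h' = b from h1)
      · rcases hend with ⟨h1, _⟩ | ⟨h1, _⟩
        · have hxh : x = h' := (show h' = x from h1).symm
          rw [hxh] at hcx hxDa
          have h2 : S (Sum.inr 2) = true := by
            by_contra h2
            rw [Bool.not_eq_true] at h2
            exact hxDa (subset_cluster_compl_a (Or.inr ⟨h2, G.self_mem_cluster _ h'⟩))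
          exact hcx.trans (Conn.of_openAdj
            ((G.attachTwoHubOpen a b h h').openAdj_of_open (Sum.inr 2) h2))
        · exact absurd (show h' = b from h1) hh'b
      · exfalso
        rcases hend with ⟨h1, _⟩ | ⟨h1, _⟩
        · exact hxDa ((show a = x from h1) ▸ (G.attachTwoHub a b h h').self_mem_cluster _ a)
        · exact hab (show a = b from h1)
  refine ⟨⟨⟨hca', hg'.conn⟩, ?_, ?_, ?_⟩, hg'⟩
  · intro hc
    exact hS.2.1 (by rw [← hext]; exact conn_attach_of_conn_open (compl_extendOpen_map _) hc)
  · intro hc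
    exact hS.2.2.1 (by rw [← hext]; exact conn_attach_of_conn_open (compl_extendOpen_map _) hc)
  · intro hc
    exact hS.2.2.2 (by rw [← hext]; exact conn_attach_of_conn_open (compl_extendOpen_map _) hc)

end Transfer

end MultiGraph

end PercRepro
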